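import Mathlib
import Literature.Computability.AlgebraicComplexity.StandardFamilies
import Summits.ValiantsHypothesis.ValiantsHypothesis.Theses.FermionicJet

/-!
# Route FermionicJet — support item `PencilEndpoints`

The fermionic (cycle-fugacity) pencil
`F_n(t) = Σ_σ sgn(σ) · t^{c(σ)} · Π_i X(σ i, i)`, with `c(σ)` the number of cycles of `σ`
(fixed points included, written in the route file as
`Multiset.card σ.cycleType + #{i | σ i = i}`), has the two integrable endpoints
`F_n(1) = det_n` and `F_n(-1) = (-1)^n · per_n` (MacMahon; the Vere-Jones `α`-determinant at
`α = -1`).  The first is `Matrix.det_apply` for the generic matrix; the second is the sign identity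
`sgn(σ) · (-1)^{c(σ)} = (-1)^n`, i.e. `sgn(σ) = (-1)^{n - c(σ)}`, which follows from Mathlib's
`Equiv.Perm.sign_of_cycleType` (`sgn σ = (-1)^{Σ cycleType + card cycleType}`) and
`Equiv.Perm.sum_cycleType` (`Σ cycleType = #support`), together with `#support + #fix = n`.

Closes item `stmt-ValiantsHypothesis-5347` of route `route-ValiantsHypothesis-FermionicJet`.
-/

open MvPolynomial Finset

namespace Summit.ValiantsHypothesis.ValiantsHypothesis.Theorems

-- `Summit.ValiantsHypothesis.ValiantsHypothesis.…` is the tree's mandated single-conjunct layout (Sub = Summit).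
set_option linter.dupNamespace false

/-- The number of fixed points plus the size of the support of a permutation of `Fin n` is `n`
(the filter `{i | σ i = i}` is the complement of `σ.support`). -/
theorem fermionicJet_card_fixed_add_card_support {n : ℕ} (σ : Equiv.Perm (Fin n)) :
    (Finset.univ.filter (fun i => σ i = i)).card + σ.support.card = n := by
  have hfix : (Finset.univ.filter (fun i => σ i = i)) = σ.supportᶜ := by
    ext i
    simp [Equiv.Perm.mem_support]
  rw [hfix, Finset.card_compl, Fintype.card_fin]
  have h := Finset.card_le_univ σ.support
  rw [Fintype.card_fin] at h
  omega

/-- MacMahon's sign identity behind `F_n(-1) = (-1)^n per_n`: for every permutation `σ` of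
`Fin n`, `sgn(σ) · (-1)^{c(σ)} = (-1)^n`, where `c(σ) = card (cycleType σ) + #{i | σ i = i}` is the
number of cycles of `σ` counted with fixed points. -/
theorem fermionicJet_sign_mul_neg_one_pow_numCycles {n : ℕ} (σ : Equiv.Perm (Fin n)) :
    ((Equiv.Perm.sign σ : ℤ) : ℂ) *
        (-1 : ℂ) ^ (Multiset.card σ.cycleType + (Finset.univ.filter (fun i => σ i = i)).card) =
      (-1 : ℂ) ^ n := by
  have hcard := fermionicJet_card_fixed_add_card_support σ
  rw [Equiv.Perm.sign_of_cycleType, Equiv.Perm.sum_cycleType]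
  simp only [Units.val_pow_eq_pow_val, Units.val_neg, Units.val_one, Int.cast_pow, Int.cast_neg,
    Int.cast_one]
  rw [← pow_add]
  have h2 : σ.support.card + Multiset.card σ.cycleType +
      (Multiset.card σ.cycleType + (Finset.univ.filter (fun i => σ i = i)).card) =
      n + 2 * Multiset.card σ.cycleType := by
    omega
  rw [h2, pow_add, pow_mul]
  norm_num

/-- **Support item `PencilEndpoints`** (route FermionicJet, item stmt-ValiantsHypothesis-5347):
the fermionic pencil `F_n(t) = Σ_σ sgn(σ) t^{c(σ)} Π_i X(σ i, i)` satisfies `F_n(1) = detPoly` and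
`F_n(-1) = C((-1)^n) * perPoly` for every `n`, in the tree's `detPoly` / `perPoly` conventions
(`Π_i X(σ i, i)`). -/
theorem pencilEndpoints_proof :
    Summit.ValiantsHypothesis.ValiantsHypothesis.Theses.FermionicJet.PencilEndpoints := by
  unfold Summit.ValiantsHypothesis.ValiantsHypothesis.Theses.FermionicJet.PencilEndpoints
  intro n
  refine ⟨?_, ?_⟩
  · -- the free-fermion point `t = 1`: the determinant
    simp only [one_pow, mul_one]
    rw [Literature.Computability.AlgebraicComplexity.detPoly, Matrix.det_apply']
    refine Finset.sum_congr rfl fun σ _ => ?_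
    simp only [Matrix.mvPolynomialX_apply, map_intCast]
  · -- the bosonic point `t = -1`: `(-1)^n` times the permanent
    simp only
    rw [Literature.Computability.AlgebraicComplexity.perPoly, Matrix.permanent, Finset.mul_sum]
    refine Finset.sum_congr rfl fun σ _ => ?_
    rw [fermionicJet_sign_mul_neg_one_pow_numCycles σ]
    simp only [Matrix.mvPolynomialX_apply]

end Summit.ValiantsHypothesis.ValiantsHypothesis.Theorems
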